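import Summits.AtomisticToContinuum.HydrodynamicLimit.Theorems.OneFlightGossipEngineEnergyCurrentTailsLevelCensusSplitFloorRung0
import Summits.AtomisticToContinuum.HydrodynamicLimit.Theorems.OneFlightGossipEngineEnergyCurrentTailsLevelCensusMergeClasses
import HarnessLib

/-!
# Crux `EnergyCurrentTails` (stmt-AtomisticToContinuum-9235), line `quartic-schur-ledger`:
# rung-0 certificate of the quartic fast-particle collision-rate floor RF₂

Stub worker file for the registered audit stub `stub_fastCollisionRateQuarticRung0` of the line lead's
skeleton `Cruxes/EnergyCurrentTails/Lines/quartic_schur_ledger.lean` (primary crux decl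
`Summit.AtomisticToContinuum.HydrodynamicLimit.Theses.WarmColdDichotomy.EnergyCurrentTails`).

**Statement.**  At global equilibrium with drift (`G_N = localGibbsLaw σ a u θ̄`, constant profiles
`a, θ̄ > 0`, `u`), for `0 < σ < σ₀` and every flow family there are `N`-independent `K₀ ≥ 0`, `c > 0` and
`N₀` with, for all `N ≥ N₀` and ALL windows `0 ≤ s ≤ t`,
`ofReal(c σ²(N+1)^{1/3}) ∫_{(s,t]} E_G[(N+1)⁻¹ Σᵢ 𝟙{K₀ < ‖vᵢ(τ)‖} ‖vᵢ(τ)‖⁵] dτ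
   ≤ E_G[Σ_{collisions in (s,t]} Σ_{ordered contact pairs (i,j)} 𝟙{K₀ < ‖vᵢ⁻‖} (N+1)⁻¹ ‖vᵢ⁻‖⁴]`
(RF₂ `stub_fastCollisionRateQuartic` at constant profiles).

**Proof.**  LEFT: the homogeneous law is invariant along every hard-sphere flow and its one-body
velocity marginal is `N(u, θ̄ I₃)` (`avgMoment_flow_localGibbsLaw_drift`), so the inner expectation is the
constant `m = E_{N(u,θ̄)}[𝟙{K₀<‖w‖}‖w‖⁵] ≤ E‖w‖⁵ < ∞` and the left side is `ofReal(c κ_N) · m · (t − s)`.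
RIGHT: take `K₀ = √E` for a level `E ≥ max(Eth, 1)` of seat c2's LANDED rung-0 splitting floor
`stub_splitFloorRung0` (line `level-census-comparison`): a SPLITTING collision at level `E` has its faster
incoming participant above energy `E`, i.e. one of the two ordered contact pairs `(i,j)` of the collision has
`‖vᵢ⁻‖ > K₀` (`ofConfig_preVel_eq_collidePair`, `collidePair_comm` at contact), so pathwise on the good set
`ofReal((N+1)⁻¹K₀⁴) · eventSum (splitEvent E) ≤` the right integrand, and in expectation
`ofReal((N+1)⁻¹K₀⁴) · eventCount(s,t](splitEvent E) ≤ RIGHT`.  The floor gives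
`eventCount ≥ ofReal(c₂ κ_N √E (t−s)) · inf_r shellCensus(r)`, and at rung 0 the shell census is the constant
`(N+1) · N(u,θ̄)(E < ‖v‖² ≤ 3E/2) > 0` (`shellCensus_const`; a Gaussian charges open sets).  The factors
`(N+1)⁻¹ (N+1)` cancel, whence RIGHT `≥ ofReal(K₀⁴ c₂ √E γ_shell · κ_N (t − s))`, and
`c := K₀⁴ c₂ √E γ_shell / (E‖w‖⁵ + 1)` serves, with `N₀ := N₃` of the floor.

References: Cercignani–Illner–Pulvirenti 1994 §2.2, §4.2, App. 4.A (collision cylinders, records of the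
flow); Ruelle 1969 §4.2 (low-density pair bound behind the splitting floor).
-/

noncomputable section

open MeasureTheory Set Filter
open scoped ENNReal InnerProductSpace

namespace Summit.AtomisticToContinuum.HydrodynamicLimit.Theorems.QuarticSchurLedger

open Literature.MathematicalPhysics.KineticTheory Literature.Analysis.FluidPDE
open Summit.AtomisticToContinuum.HydrodynamicLimit.Theorems.EnergyCurrentTailsLevelCensus

/-! ### Gaussian shells have positive mass -/

-- adapted from Summits/…/Theorems/GibbsLightCone/Negative/IdealGas.lean (`gaussMeasure_pos_of_isOpen`,
-- centred case) to a general drift `u`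
/-- A drifted Gaussian on `ℝ³` charges every nonempty open set (positive continuous density
`withDensity_localMaxwellian_eq_gaussMeasure`, `localMaxwellian_pos`). [folklore] -/
theorem c5rf_gaussMeasure_pos_of_isOpen {θ : ℝ} (hθ : 0 < θ) (u : V3) {S : Set V3} (hS : IsOpen S)
    (hne : S.Nonempty) : 0 < gaussMeasure u θ S := by
  rw [← withDensity_localMaxwellian_eq_gaussMeasure hθ u, pos_iff_ne_zero, Ne,
    withDensity_apply_eq_zero'
      (continuous_localMaxwellian 1 θ u).measurable.ennreal_ofReal.aemeasurable]
  have hset : {v : V3 | ENNReal.ofReal (localMaxwellian 1 θ u v) ≠ 0} = univ :=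
    eq_univ_of_forall fun v => (ENNReal.ofReal_pos.2 (localMaxwellian_pos one_pos hθ _ _)).ne'
  rw [hset, univ_inter]
  exact (hS.measure_pos volume hne).ne'

/-- The Gaussian mass of the energy shell `{E < ‖v‖² ≤ 3E/2}` is positive for `E > 0` (it contains the
open shell `{E < ‖v‖² < 3E/2}`, which contains the vector `√(5E/4) e₀`). [folklore] -/
theorem c5rf_gaussMeasure_shell_ne_zero {θ : ℝ} (hθ : 0 < θ) (u : V3) {E : ℝ} (hE : 0 < E) :
    gaussMeasure u θ {v : V3 | E < ‖v‖ ^ 2 ∧ ‖v‖ ^ 2 ≤ 3 / 2 * E} ≠ 0 := by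
  have hopen : IsOpen {v : V3 | E < ‖v‖ ^ 2 ∧ ‖v‖ ^ 2 < 3 / 2 * E} := by
    have hc : Continuous fun v : V3 => ‖v‖ ^ 2 := by fun_prop
    exact (isOpen_lt continuous_const hc).inter (isOpen_lt hc continuous_const)
  have hne : ({v : V3 | E < ‖v‖ ^ 2 ∧ ‖v‖ ^ 2 < 3 / 2 * E}).Nonempty := by
    refine ⟨(PiLp.single 2 (0 : Fin 3) (Real.sqrt (5 / 4 * E)) : V3), ?_⟩
    have hn : ‖(PiLp.single 2 (0 : Fin 3) (Real.sqrt (5 / 4 * E)) : V3)‖ ^ 2 = 5 / 4 * E := by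
      rw [PiLp.norm_single, Real.norm_eq_abs, abs_of_nonneg (Real.sqrt_nonneg _),
        Real.sq_sqrt (by positivity)]
    simp only [Set.mem_setOf_eq, hn]
    constructor <;> linarith
  have hpos := c5rf_gaussMeasure_pos_of_isOpen hθ u hopen hne
  refine fun h0 => (hpos.trans_le (measure_mono ?_)).ne' h0
  intro v hv
  exact ⟨hv.1, hv.2.le⟩

/-! ### One collision: a splitting collision has a fast ordered contact pair -/

-- adapted from `leadBridge_sum_contactPairs_eq_ite_indicator` of
-- Summits/…/Theorems/OneFlightGossipEngineEnergyCurrentTailsFluxCeilingGlue.lean (inlined to keep imports small)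
/-- **Inline (route) form of one collision term.**  Inside the hard-sphere domain, the sum over the ordered
contact pairs of `f` is the routes' double sum `∑ i, ∑ j, if i = j then 0 else 𝟙_{contactSet i j}(y) · f i j`.
[folklore] -/
theorem c5rf_sum_contactPairs_eq_ite_indicator {d X : Type*} [Fintype d] {G : Geometry d X} {ε : ℝ} {n : ℕ}
    {M : Type*} [AddCommMonoid M] {y : Config n d X} (hy : y ∈ hardSphereDomain G n ε)
    (f : Config n d X → Fin n → Fin n → M) :
    ∑ p ∈ contactPairs G ε y, f y p.1 p.2 =
      ∑ i, ∑ j, if i = j then (0 : M) else (contactSet G n ε i j).indicator (fun w => f w i j) y := by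
  rw [sum_contactPairs_eq hy]
  refine Finset.sum_congr rfl fun i _ => Finset.sum_congr rfl fun j _ => ?_
  by_cases hij : i = j
  · simp [hij]
  · by_cases hc : ‖G.sepVec (y i).1 (y j).1‖ = ε
    · have hmem : y ∈ contactSet G n ε i j := mem_contactSet.2 ⟨hy, hc⟩
      simp [hij, hc, Set.indicator_of_mem hmem]
    · have hnmem : y ∉ contactSet G n ε i j := fun h => hc (mem_contactSet.1 h).2
      simp [hij, hc, Set.indicator_of_notMem hnmem]

/-- **Core of the comparison, one collision with first label smaller.**  On `𝕋³` with `ε < 1/2`, if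
`(a, b)` with `a < b` is an ordered contact pair of `y`, then over the two orientations `{(a,b), (b,a)}`:
`ofReal(C (√E)⁴) · Σ_p [p.1 < p.2] 𝟙_{splitEvent E}(record p) ≤ Σ_p 𝟙{√E < ‖v_{p.1}⁻‖} ofReal(C ‖v_{p.1}⁻‖⁴)`
— a splitting collision has `E < max(‖v_a⁻‖², ‖v_b⁻‖²)`, the record's incoming velocities are those of
`collidePair a b y` (`ofConfig_preVel_eq_collidePair`), and `collidePair b a y = collidePair a b y` at contact
(`collidePair_comm`). [folklore] -/
theorem c5rf_guard_pair_le {N : ℕ} {ε : ℝ} (hε2 : ε < 2⁻¹) {y : Config (N + 1) (Fin 3) T3} {a b : Fin (N + 1)}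
    (hlt : a < b) (hab : (a, b) ∈ contactPairs (Torus.geometry (Fin 3)) ε y) {E C : ℝ} (hE : 0 ≤ E)
    (hC : 0 ≤ C) (t : ℝ) :
    ENNReal.ofReal (C * Real.sqrt E ^ 4) *
        (∑ p ∈ ({(a, b), (b, a)} : Finset (Fin (N + 1) × Fin (N + 1))),
          (if p.1 < p.2 then (splitEvent E).indicator (fun _ => (1 : ℝ≥0∞))
            ((HardSphereCollisionRecord.ofConfig (Torus.geometry (Fin 3)) ε y t p.1 p.2).preVel,
              (HardSphereCollisionRecord.ofConfig (Torus.geometry (Fin 3)) ε y t p.1 p.2).postVel) else 0)) ≤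
      ∑ p ∈ ({(a, b), (b, a)} : Finset (Fin (N + 1) × Fin (N + 1))),
        (if Real.sqrt E < ‖(collidePair (Torus.geometry (Fin 3)) p.1 p.2 y p.1).2‖ then
          ENNReal.ofReal (C * ‖(collidePair (Torus.geometry (Fin 3)) p.1 p.2 y p.1).2‖ ^ 4) else 0) := by
  have hG : (Torus.geometry (Fin 3)).IsHardSphereRegular ε := Torus.isHardSphereRegular_geometry hε2
  have hne : a ≠ b := hlt.ne
  have hne2 : ((a, b) : Fin (N + 1) × Fin (N + 1)) ≠ (b, a) := fun h => hne (Prod.mk.inj h).1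
  obtain ⟨-, hc⟩ := mem_contactPairs.1 hab
  have hsep : ‖(Torus.geometry (Fin 3)).sepVec (y a).1 (y b).1‖ = ε := (mem_contactSet.1 hc).2
  rw [Finset.sum_pair hne2, Finset.sum_pair hne2, if_pos hlt, if_neg (not_lt.2 hlt.le), add_zero]
  -- the two incoming velocities
  have hpre : (HardSphereCollisionRecord.ofConfig (Torus.geometry (Fin 3)) ε y t a b).preVel =
      ((collidePair (Torus.geometry (Fin 3)) a b y a).2, (collidePair (Torus.geometry (Fin 3)) a b y b).2) :=
    HardSphereCollisionRecord.ofConfig_preVel_eq_collidePair _ ε y t hne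
  have hcomm : collidePair (Torus.geometry (Fin 3)) b a y = collidePair (Torus.geometry (Fin 3)) a b y :=
    hG.collidePair_comm hne hsep.le
  -- the value of one fast term
  have hterm : ∀ w : V3, E < ‖w‖ ^ 2 →
      ENNReal.ofReal (C * Real.sqrt E ^ 4) ≤
        (if Real.sqrt E < ‖w‖ then ENNReal.ofReal (C * ‖w‖ ^ 4) else 0) := by
    intro w hw
    have hlt' : Real.sqrt E < ‖w‖ := by
      have h := Real.sqrt_lt_sqrt hE hw
      rwa [Real.sqrt_sq (norm_nonneg _)] at h
    rw [if_pos hlt']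
    exact ENNReal.ofReal_le_ofReal
      (mul_le_mul_of_nonneg_left (pow_le_pow_left₀ (Real.sqrt_nonneg E) hlt'.le 4) hC)
  by_cases hm : ((HardSphereCollisionRecord.ofConfig (Torus.geometry (Fin 3)) ε y t a b).preVel,
      (HardSphereCollisionRecord.ofConfig (Torus.geometry (Fin 3)) ε y t a b).postVel) ∈ splitEvent E
  · rw [Set.indicator_of_mem hm, mul_one]
    have hmax : E < max (‖(collidePair (Torus.geometry (Fin 3)) a b y a).2‖ ^ 2)
        (‖(collidePair (Torus.geometry (Fin 3)) a b y b).2‖ ^ 2) := by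
      have h1 := hm.1
      simp only [maxPre, hpre] at h1
      exact h1
    rcases lt_max_iff.1 hmax with h1 | h2
    · exact (hterm _ h1).trans le_self_add
    · rw [hcomm]
      exact (hterm _ h2).trans le_add_self
  · rw [Set.indicator_of_notMem hm, mul_zero]
    exact zero_le

section Flow

variable {σ : ℝ} {N : ℕ}

/-- **Pathwise comparison on the good set.**  For `0 < σ < 1/2`, a flow `Φ`, a good datum `z`, `E, C ≥ 0`
and a window `(s, t]`:
`ofReal(C (√E)⁴) · eventSum Φ s t (splitEvent E) z ≤ Σ_{collisions in (s,t]} Σᵢ Σⱼ [i ≠ j] 𝟙_{contactSet i j}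
  · 𝟙{√E < ‖vᵢ⁻‖} ofReal(C ‖vᵢ⁻‖⁴)` — collision by collision (`contactPairs_eq_pair`, `c5rf_guard_pair_le`).
[folklore] -/
theorem c5rf_eventSum_le_finsum (hσ : 0 < σ) (hσ2 : σ < 1 / 2) (Φ : Flow σ N)
    {z : Config (N + 1) (Fin 3) T3} (hz : z ∈ Φ.good) {E C : ℝ} (hE : 0 ≤ E) (hC : 0 ≤ C) (s t : ℝ) :
    ENNReal.ofReal (C * Real.sqrt E ^ 4) * eventSum Φ s t (splitEvent E) z ≤
      ∑ᶠ τ ∈ collisionTimes (Torus.geometry (Fin 3)) (hsDiameter σ N) (fun r => Φ.flow r z) ∩ Set.Ioc s t,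
        ∑ i : Fin (N + 1), ∑ j : Fin (N + 1), if i = j then (0 : ℝ≥0∞) else
          (contactSet (Torus.geometry (Fin 3)) (N + 1) (hsDiameter σ N) i j).indicator
            (fun y => if Real.sqrt E < ‖((collidePair (Torus.geometry (Fin 3)) i j y) i).2‖ then
              ENNReal.ofReal (C * ‖((collidePair (Torus.geometry (Fin 3)) i j y) i).2‖ ^ 4) else 0)
            (Φ.flow τ z) := by
  have hε2 : hsDiameter σ N < 2⁻¹ := (hsDiameter_le hσ.le N).trans_lt (by norm_num at hσ2 ⊢; linarith)
  have hG : (Torus.geometry (Fin 3)).IsHardSphereRegular (hsDiameter σ N) :=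
    Torus.isHardSphereRegular_geometry hε2
  have htraj := Φ.isTrajectory z hz
  have hfin : (collisionTimes (Torus.geometry (Fin 3)) (hsDiameter σ N) (fun r => Φ.flow r z) ∩
      Set.Ioc s t).Finite := Φ.finite_collisionTimes_inter hz Set.Ioc_subset_Icc_self
  rw [eventSum, HardSphereFlow.collisionSum_eq, Literature.Analysis.FluidPDE.collisionSum_eq_collisionPairSum,
    collisionPairSum_eq_finset_sum hfin, finsum_mem_eq_finite_toFinset_sum _ hfin, Finset.mul_sum]
  refine Finset.sum_le_sum fun τ hτ => ?_
  have hτ' : τ ∈ collisionTimes (Torus.geometry (Fin 3)) (hsDiameter σ N) (fun r => Φ.flow r z) :=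
    ((Set.Finite.mem_toFinset hfin).1 hτ).1
  have hdom : Φ.flow τ z ∈ hardSphereDomain (Torus.geometry (Fin 3)) (N + 1) (hsDiameter σ N) := htraj.mem τ
  rw [← c5rf_sum_contactPairs_eq_ite_indicator hdom (fun y i j =>
    if Real.sqrt E < ‖((collidePair (Torus.geometry (Fin 3)) i j y) i).2‖ then
      ENNReal.ofReal (C * ‖((collidePair (Torus.geometry (Fin 3)) i j y) i).2‖ ^ 4) else 0)]
  simp only [HardSphereCollisionRecord.ofConfig_fst, HardSphereCollisionRecord.ofConfig_snd]
  obtain ⟨⟨a, b⟩, hab⟩ := mem_collisionTimes_iff_contactPairs_nonempty.1 hτ'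
  rcases lt_or_gt_of_ne (mem_contactPairs.1 hab).1 with hlt | hgt
  · rw [htraj.contactPairs_eq_pair hG hab]
    exact c5rf_guard_pair_le hε2 hlt hab hE hC τ
  · have hba : ((b, a) : Fin (N + 1) × Fin (N + 1)) ∈
        contactPairs (Torus.geometry (Fin 3)) (hsDiameter σ N) (Φ.flow τ z) :=
      (swap_mem_contactPairs_iff hG (p := (a, b))).2 hab
    rw [htraj.contactPairs_eq_pair hG hba]
    exact c5rf_guard_pair_le hε2 hgt hba hE hC τ

/-- **Expected comparison.**  `ofReal(C (√E)⁴) · eventCount(s,t](splitEvent E) ≤ E_G[right integrand]` (the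
good set is conull, `ae_mem_good_localGibbsLaw`). [folklore] -/
theorem c5rf_eventCount_le_lintegral (hσ : 0 < σ) (hσ2 : σ < 1 / 2) (a₀ θ₀ : T3 → ℝ) (u₀ : T3 → V3)
    (Φ : Flow σ N) {E C : ℝ} (hE : 0 ≤ E) (hC : 0 ≤ C) (s t : ℝ) :
    ENNReal.ofReal (C * Real.sqrt E ^ 4) * eventCount σ a₀ θ₀ u₀ N Φ s t (splitEvent E) ≤
      ∫⁻ z, (∑ᶠ τ ∈ collisionTimes (Torus.geometry (Fin 3)) (hsDiameter σ N) (fun r => Φ.flow r z) ∩ Set.Ioc s t,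
        ∑ i : Fin (N + 1), ∑ j : Fin (N + 1), if i = j then (0 : ℝ≥0∞) else
          (contactSet (Torus.geometry (Fin 3)) (N + 1) (hsDiameter σ N) i j).indicator
            (fun y => if Real.sqrt E < ‖((collidePair (Torus.geometry (Fin 3)) i j y) i).2‖ then
              ENNReal.ofReal (C * ‖((collidePair (Torus.geometry (Fin 3)) i j y) i).2‖ ^ 4) else 0)
            (Φ.flow τ z)) ∂(localGibbsLaw σ a₀ u₀ θ₀ N Φ) := by
  unfold eventCount
  rw [← lintegral_const_mul' _ _ ENNReal.ofReal_ne_top]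
  refine lintegral_mono_ae ?_
  filter_upwards [Literature.MathematicalPhysics.KineticTheory.ae_mem_good_localGibbsLaw σ a₀ u₀ θ₀ N Φ] with z hz
  exact c5rf_eventSum_le_finsum hσ hσ2 Φ hz hE hC s t

end Flow

/-! ### The certificate -/

/-- **Audit stub `stub_fastCollisionRateQuarticRung0` — RF₂ at rung 0 (global equilibrium with drift),
uniformly in `N ≥ N₀` and in the window.**  For constant profiles `a, θ̄ > 0`, drift `u`, there is
`σ₀ > 0` such that for `0 < σ < σ₀` and every flow family there are `K₀ ≥ 0`, `c > 0`, `N₀` with, for all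
`N ≥ N₀` and `0 ≤ s ≤ t`,
`ofReal(c σ²(N+1)^{1/3}) ∫_{(s,t]} E_G[(N+1)⁻¹Σᵢ 𝟙{K₀<‖vᵢ(τ)‖}‖vᵢ(τ)‖⁵] dτ ≤ E_G[Σ_{coll ∈ (s,t]} Σ_{(i,j)} 𝟙{K₀<‖vᵢ⁻‖}(N+1)⁻¹‖vᵢ⁻‖⁴]`.
Proof: LEFT `= ofReal(c κ_N) · E_{N(u,θ̄)}[𝟙{K₀<‖w‖}‖w‖⁵] · (t−s)` (stationarity + one-body marginal,
`avgMoment_flow_localGibbsLaw_drift`), `≤ … E‖w‖⁵`; RIGHT `≥ ofReal((N+1)⁻¹K₀⁴) · eventCount(splitEvent E)` for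
`K₀ = √E` (`c5rf_eventCount_le_lintegral`) `≥ ofReal((N+1)⁻¹K₀⁴) ofReal(c₂ κ_N √E (t−s)) (N+1) γ_shell` by the
landed splitting floor `stub_splitFloorRung0` and `shellCensus_const`; `E := max(Eth, 1)`,
`c := K₀⁴ c₂ √E γ_shell/(E‖w‖⁵ + 1)`. [folklore] -/
theorem stub_fastCollisionRateQuarticRung0 :
    ∀ (a θb : ℝ) (u : V3), 0 < a → 0 < θb →
      ∃ σ₀ : ℝ, 0 < σ₀ ∧ ∀ σ : ℝ, 0 < σ → σ < σ₀ →
        ∀ Φ : ((N : ℕ) → HardSphereFlow (Torus.geometry (Fin 3)) (hsDiameter σ N) (N + 1)),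
          ∃ K₀ : ℝ, 0 ≤ K₀ ∧ ∃ c : ℝ, 0 < c ∧ ∃ N₀ : ℕ, ∀ N : ℕ, N₀ ≤ N →
            ∀ s t : ℝ, 0 ≤ s → s ≤ t →
              ENNReal.ofReal (c * (σ ^ 2 * ((N + 1 : ℕ) : ℝ) ^ ((1 : ℝ) / 3))) *
                  ∫⁻ τ in Set.Ioc s t, (∫⁻ z, ENNReal.ofReal (((N + 1 : ℕ) : ℝ)⁻¹ *
                    ∑ i : Fin (N + 1), if K₀ < ‖(((Φ N).flow τ z) i).2‖ then
                      ‖(((Φ N).flow τ z) i).2‖ ^ 5 else 0) ∂(localGibbsLaw σ (fun _ => a) (fun _ => u) (fun _ => θb) N (Φ N))) ≤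
                ∫⁻ z, (∑ᶠ τ ∈ collisionTimes (Torus.geometry (Fin 3)) (hsDiameter σ N)
                    (fun r => (Φ N).flow r z) ∩ Set.Ioc s t,
                  ∑ i : Fin (N + 1), ∑ j : Fin (N + 1), if i = j then (0 : ℝ≥0∞) else
                    (contactSet (Torus.geometry (Fin 3)) (N + 1) (hsDiameter σ N) i j).indicator
                      (fun y => if K₀ < ‖((collidePair (Torus.geometry (Fin 3)) i j y) i).2‖ then
                        ENNReal.ofReal (((N + 1 : ℕ) : ℝ)⁻¹ *
                          ‖((collidePair (Torus.geometry (Fin 3)) i j y) i).2‖ ^ 4) else 0)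
                      ((Φ N).flow τ z)) ∂(localGibbsLaw σ (fun _ => a) (fun _ => u) (fun _ => θb) N (Φ N)) := by
  intro a θb u ha hθ
  obtain ⟨σ₁, hσ₁, hsplit⟩ := stub_splitFloorRung0 a θb u ha hθ
  refine ⟨min σ₁ (1 / 2), lt_min hσ₁ one_half_pos, fun σ hσ hσlt Φ => ?_⟩
  have hσ₁' : σ < σ₁ := hσlt.trans_le (min_le_left _ _)
  have hσ2 : σ < 1 / 2 := hσlt.trans_le (min_le_right _ _)
  obtain ⟨cs, hcs, Eth, N₃, hfloor⟩ := hsplit σ hσ hσ₁' Φ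
  -- the level and the threshold
  set E : ℝ := max Eth 1 with hEdef
  have hE1 : 1 ≤ E := le_max_right _ _
  have hE0 : 0 < E := by linarith
  have hEth : Eth ≤ E := le_max_left _ _
  set K₀ : ℝ := Real.sqrt E with hK₀def
  have hK₀pos : 0 < K₀ := Real.sqrt_pos.2 hE0
  -- Gaussian constants: the shell mass and the fifth moment
  set γS : ℝ≥0∞ := gaussMeasure u θb {v : V3 | E < ‖v‖ ^ 2 ∧ ‖v‖ ^ 2 ≤ 3 / 2 * E} with hγSdef
  have hγStop : γS ≠ ⊤ := measure_ne_top _ _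
  have hγSpos : γS ≠ 0 := c5rf_gaussMeasure_shell_ne_zero hθ u hE0
  have hγSr : 0 < γS.toReal := ENNReal.toReal_pos hγSpos hγStop
  set m₅ : ℝ≥0∞ := ∫⁻ w, ENNReal.ofReal (‖w‖ ^ 5) ∂(gaussMeasure u θb) with hm₅def
  have hm₅top : m₅ ≠ ⊤ := lintegral_norm_pow_gaussMeasure_ne_top u θb (k := 5) (by norm_num)
  have hm₅r : 0 ≤ m₅.toReal := ENNReal.toReal_nonneg
  set c : ℝ := K₀ ^ 4 * cs * Real.sqrt E * γS.toReal / (m₅.toReal + 1) with hcdef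
  have hA : 0 < K₀ ^ 4 * cs * Real.sqrt E * γS.toReal := by positivity
  have hc : 0 < c := by rw [hcdef]; positivity
  refine ⟨K₀, hK₀pos.le, c, hc, N₃, fun N hN s t hs hst => ?_⟩
  set P := localGibbsLaw σ (fun _ => a) (fun _ => u) (fun _ => θb) N (Φ N) with hPdef
  have hcast : ((N + 1 : ℕ) : ℝ) = (N : ℝ) + 1 := by push_cast; ring
  have hts : 0 ≤ t - s := sub_nonneg.2 hst
  -- LEFT: the inner expectation is the constant Gaussian moment `m ≤ m₅`
  set m : ℝ≥0∞ := ∫⁻ w, ENNReal.ofReal (if K₀ < ‖w‖ then ‖w‖ ^ 5 else 0) ∂(gaussMeasure u θb) with hmdef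
  have hhm : Measurable fun w : V3 => if K₀ < ‖w‖ then ‖w‖ ^ 5 else 0 :=
    Measurable.ite (measurableSet_lt measurable_const measurable_norm) (measurable_norm.pow_const 5)
      measurable_const
  have hh0 : ∀ w : V3, 0 ≤ (if K₀ < ‖w‖ then ‖w‖ ^ 5 else 0) := fun w => by split_ifs <;> positivity
  have hinner : ∀ τ : ℝ, (∫⁻ z, ENNReal.ofReal (((N + 1 : ℕ) : ℝ)⁻¹ *
      ∑ i : Fin (N + 1), (if K₀ < ‖((Φ N).flow τ z i).2‖ then ‖((Φ N).flow τ z i).2‖ ^ 5 else 0)) ∂P) = m := by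
    intro τ
    rw [hcast]
    exact avgMoment_flow_localGibbsLaw_drift hσ2.le ha hθ u N (Φ N) τ hhm hh0
  have hm5 : m ≤ m₅ :=
    lintegral_mono fun w => ENNReal.ofReal_le_ofReal (by split_ifs <;> [exact le_rfl; positivity])
  have hLEFT : (∫⁻ τ in Set.Ioc s t, (∫⁻ z, ENNReal.ofReal (((N + 1 : ℕ) : ℝ)⁻¹ *
      ∑ i : Fin (N + 1), (if K₀ < ‖((Φ N).flow τ z i).2‖ then ‖((Φ N).flow τ z i).2‖ ^ 5 else 0)) ∂P)) ≤
      m₅ * ENNReal.ofReal (t - s) := by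
    calc (∫⁻ τ in Set.Ioc s t, (∫⁻ z, ENNReal.ofReal (((N + 1 : ℕ) : ℝ)⁻¹ *
          ∑ i : Fin (N + 1), (if K₀ < ‖((Φ N).flow τ z i).2‖ then ‖((Φ N).flow τ z i).2‖ ^ 5 else 0)) ∂P))
        = ∫⁻ _τ in Set.Ioc s t, m := lintegral_congr fun τ => hinner τ
      _ = m * volume (Set.Ioc s t) := setLIntegral_const _ _
      _ = m * ENNReal.ofReal (t - s) := by rw [Real.volume_Ioc]
      _ ≤ m₅ * ENNReal.ofReal (t - s) := mul_le_mul' hm5 le_rfl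
  -- RIGHT: the splitting count at level `E`, the floor, the census at rung 0
  have hRIGHT := c5rf_eventCount_le_lintegral hσ hσ2 (fun _ => a) (fun _ => θb) (fun _ => u) (Φ N) hE0.le
    (inv_nonneg.2 (Nat.cast_nonneg (N + 1))) s t (C := ((N + 1 : ℕ) : ℝ)⁻¹)
  have hcount := hfloor N hN s t hs hst E hEth
  have hcensus : ((N + 1 : ℕ) : ℝ≥0∞) * γS ≤
      ⨅ r ∈ Set.Icc s t, shellCensus σ (fun _ => a) (fun _ => θb) (fun _ => u) N (Φ N) r E (3 / 2 * E) :=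
    le_iInf₂ fun r _ => (shellCensus_const hσ2.le ha hθ u N (Φ N) r E (3 / 2 * E)).ge
  -- constants
  have hK4 : K₀ ^ 4 = Real.sqrt E ^ 4 := by rw [hK₀def]
  have hclock0 : 0 ≤ clock σ N := by unfold clock; positivity
  have hclock : σ ^ 2 * ((N + 1 : ℕ) : ℝ) ^ ((1 : ℝ) / 3) = clock σ N := by rw [clock, hcast]
  have hX0 : 0 ≤ cs * clock σ N * Real.sqrt E * (t - s) := by positivity
  have hkey : c * m₅.toReal ≤ K₀ ^ 4 * cs * Real.sqrt E * γS.toReal := by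
    rw [hcdef, div_mul_eq_mul_div, div_le_iff₀ (by positivity)]
    exact mul_le_mul_of_nonneg_left (by linarith) hA.le
  have hreal : c * clock σ N * m₅.toReal * (t - s) ≤
      (((N + 1 : ℕ) : ℝ)⁻¹ * K₀ ^ 4) * ((cs * clock σ N * Real.sqrt E * (t - s)) *
        (((N + 1 : ℕ) : ℝ) * γS.toReal)) := by
    have hn : (((N + 1 : ℕ) : ℝ)) ≠ 0 := by positivity
    have e : (((N + 1 : ℕ) : ℝ)⁻¹ * K₀ ^ 4) * ((cs * clock σ N * Real.sqrt E * (t - s)) *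
        (((N + 1 : ℕ) : ℝ) * γS.toReal)) = (K₀ ^ 4 * cs * Real.sqrt E * γS.toReal) * (clock σ N * (t - s)) := by
      field_simp
    rw [e, show c * clock σ N * m₅.toReal * (t - s) = (c * m₅.toReal) * (clock σ N * (t - s)) by ring]
    exact mul_le_mul_of_nonneg_right hkey (mul_nonneg hclock0 hts)
  have hm₅eq : m₅ = ENNReal.ofReal m₅.toReal := (ENNReal.ofReal_toReal hm₅top).symm
  have hγSeq : γS = ENNReal.ofReal γS.toReal := (ENNReal.ofReal_toReal hγStop).symm
  -- assemble
  calc ENNReal.ofReal (c * (σ ^ 2 * ((N + 1 : ℕ) : ℝ) ^ ((1 : ℝ) / 3))) * _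
      ≤ ENNReal.ofReal (c * (σ ^ 2 * ((N + 1 : ℕ) : ℝ) ^ ((1 : ℝ) / 3))) * (m₅ * ENNReal.ofReal (t - s)) :=
        mul_le_mul' le_rfl hLEFT
    _ = ENNReal.ofReal (c * clock σ N * m₅.toReal * (t - s)) := by
        rw [hclock, hm₅eq, ENNReal.toReal_ofReal hm₅r, ← ENNReal.ofReal_mul hm₅r,
          ← ENNReal.ofReal_mul (mul_nonneg hc.le hclock0)]
        congr 1
        ring
    _ ≤ ENNReal.ofReal ((((N + 1 : ℕ) : ℝ)⁻¹ * K₀ ^ 4) * ((cs * clock σ N * Real.sqrt E * (t - s)) *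
          (((N + 1 : ℕ) : ℝ) * γS.toReal))) := ENNReal.ofReal_le_ofReal hreal
    _ = ENNReal.ofReal (((N + 1 : ℕ) : ℝ)⁻¹ * K₀ ^ 4) *
          (ENNReal.ofReal (cs * clock σ N * Real.sqrt E * (t - s)) * (((N + 1 : ℕ) : ℝ≥0∞) * γS)) := by
        rw [ENNReal.ofReal_mul (by positivity), ENNReal.ofReal_mul hX0, ENNReal.ofReal_mul (Nat.cast_nonneg _),
          ENNReal.ofReal_natCast, ← hγSeq]
    _ ≤ ENNReal.ofReal (((N + 1 : ℕ) : ℝ)⁻¹ * K₀ ^ 4) *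
          (ENNReal.ofReal (cs * clock σ N * Real.sqrt E * (t - s)) *
            ⨅ r ∈ Set.Icc s t, shellCensus σ (fun _ => a) (fun _ => θb) (fun _ => u) N (Φ N) r E (3 / 2 * E)) :=
        mul_le_mul' le_rfl (mul_le_mul' le_rfl hcensus)
    _ ≤ ENNReal.ofReal (((N + 1 : ℕ) : ℝ)⁻¹ * K₀ ^ 4) *
          eventCount σ (fun _ => a) (fun _ => θb) (fun _ => u) N (Φ N) s t (splitEvent E) :=
        mul_le_mul' le_rfl hcount
    _ = ENNReal.ofReal (((N + 1 : ℕ) : ℝ)⁻¹ * Real.sqrt E ^ 4) *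
          eventCount σ (fun _ => a) (fun _ => θb) (fun _ => u) N (Φ N) s t (splitEvent E) := by rw [hK4]
    _ ≤ _ := hRIGHT

end Summit.AtomisticToContinuum.HydrodynamicLimit.Theorems.QuarticSchurLedger

end
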